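import Summits.QuantumFields.BalabanUV.Beta.FP.PeriodisedWardOrderOnePotentials
import Summits.QuantumFields.BalabanUV.Beta.FP.TorusCompositeCovariance

/-!
# `BalabanUV.Beta.FP.PeriodisedWardOrderOneStoreys` — road «FP» for binder row D1, ROUTE T (β1), the OWNER d1-p3's R-FP-74 (b): the storey letters of the
# tower's `a1` closing, PART 2 — **THE Λ-FAMILY's READING SPLIT (diagonal multiplier reading + RAW next-storey remainder), BOTH PARTS IN THE NEXT ROWS'
# LETTERS, AND THE STOREY POTENTIALS' RECURSION** (sequel of `PeriodisedWardOrderOnePotentials`):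
# * §0 two finite bookkeeping identities;
# * §1 `torus_lamFamily_mul_grad_potentials_split`: `G * D = of (a e ↦ wκ · N̂(a) · (φ_e(a) + φ_e(a⁺))∕2) + Rraw`, `N̂(a) := Σ_ā h̄_ā Σ_μ Σ'_y c^per_ā(μ,y) · q¹_{(μ,y)}(a)`
#   (the un-regrouped multiplier reading of `PeriodisedWardOrderOneCompanion.torus_companion_mul_Dbar` ∕ (K1′)), `Rraw(a,e) := −wκ · Σ_ā h̄_ā Σ_μ Σ'_y c^per_ā(μ,y) ·
#   (φ_e(Lc•y + ρ_c) + φ_e(Lc•y + ρ_c + Lc•e_μ)) · q¹_{(μ,y)}(a)∕2` (the next storey's endpoint readings; `tsum_sub` on finitely supported summands);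
# * §2 `rawRem_eq_neg_smul_transpose_mul`: `Rraw = −(wκ ∕ (2·stepScale d Lc j·Lc^{d+1})) • Qᵀ * of (a′ e ↦ Λʰ a′ · (φ_e(Lc•a′ + ρ_c) + φ_e(Lc•a′ + ρ_c + Lc•e)))` through the
#   next rows `Q` (level `j`, slot map `cp`) — `…Potentials.tsum_coarse_regroup_pot_gen` with the endpoint bracket; §3 `nhat_eq_transpose_mulVec_div`: `N̂(a) = (Qᵀ Λʰ)(a) ∕
#   (stepScale d Lc j·Lc^{d+1})` — the same with the constant bracket; so §1 ⇔ `…Potentials.torus_lamFamily_mul_grad_potentials_Q`, every part now named separately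
#   (the top storey needs §1's RAW form: there its remainder vanishes termwise on residual parameters and no rows above the top are invoked);
# * §4 `rootPt_wrapPt`, `itRoot_wrapPt_succ`: the storey potentials `φ_e^{(n)}[M] := φ_e ∘ itRoot_n ∘ wrapPt M` (leaf-02's iterated centred root map `itRoot`, read at box
#   representatives) obey `φ^{(n+1)}[M](z) = φ^{(n)}[fine Lc M](Lc•z + ρ_c)` — the top-peel recursion that matches storey-`n`'s endpoint readings with storey-`(n+1)`'s
#   bond readings.
# [folklore] finite sums ∕ `tsum` splitting BY NAME over OUR typed objects; no `def`, no `def … : Prop`, nothing cited, 0 sorry; 0 estimates; discharges NO row by itself.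

HONEST DEPENDENCY (page 1, mandatory): continuum YM on T⁴ ⇐ BetaPertH ∧ nine spine estimates (0/9 proved); BetaPertH ⇐ (D1) ∧ (D4) ∧ CAP+tail;
G-an2-4 gates asym, D1 and NE2/3/4.  HONEST FRAMING (cell contract, verbatim): «discharging `BetaPertH` makes Bałaban's UV stability UNCONDITIONAL —
a real constructive-QFT result; it is NOT the continuum limit and NOT the Clay problem.»  ABSOLUTE RULE (cell charter, verbatim): «No internally-minted
statement may enter as a cited fact. Every hypothesis is either kernel-proved in this package or a verbatim quotation of a PUBLISHED theorem with page
reference. The manuscript(s) under audit are NOT citable for their own disputed steps — they are the thing under adjudication; programme-internal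
(2001/route/tribunal) claims are never citable.»  Nothing of Bałaban's ∕ the dictionary's asserted; 0∕4 row-D1 binders (hW, hR, D1Tel, D1Rep); ROOT M‴ p325680
untouched; NOT (C1), NOT (T-ID), NOT SDF, NOT D1, NEVER «G-an2-4 closed», NOT BetaPertH, NOT continuum, NOT Clay.  «not in print; our bookkeeping».
Unit `b2b-balaban-beta-d1-formalise-leaf-05` (gen 44), 2026-08-24; no existing file touched.
-/

noncomputable section

namespace Summit.QuantumFields.BalabanUV.Beta.FP.PeriodisedWardOrderOneStoreys

open scoped BigOperators Matrix
open Finset Matrix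
open Literature.MathematicalPhysics.QuantumFieldTheory.Balaban1983to89
open Literature.MathematicalPhysics.QuantumFieldTheory.Balaban1983to89.Beta
open B4TorusKernel.MultiPeriod (translate translate_apply)
open B5Prop11Plancherel (fine)
open B6Lemma24Torus (pbox mem_pbox wrap wrap_eq_self wrap_congr)
open ExpKernelCalculus (MKer)
open AffineAveraging (Site box toSite unitVec)
open AveragingContoursRooted (ctr ctrOff ctrOff_mem_box)
open OneStepResolventKernel (Fib)
open InterLevelTransport (SLam)
open Summit.QuantumFields.BalabanUV.Beta.SymAveragingHessianCounts (symHessFFAt symLinKerAt symLinKerAt_eq_zero)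
open Summit.QuantumFields.BalabanUV.Beta.BorderedHessian (stepScale)
open Summit.QuantumFields.BalabanUV.Beta.DshAn1 (Dsh)
open Summit.QuantumFields.BalabanUV.Beta.SymShiftedSpread (bhKStepSh)
open Summit.QuantumFields.BalabanUV.Beta.FP.KernelPeriodisationFib (Idx perF perF_apply perZ perZ_apply)
open Summit.QuantumFields.BalabanUV.Beta.FP.KernelPeriodisationFibLoc (dper)
open Summit.QuantumFields.BalabanUV.Beta.FP.TorusGaugeCovarianceCoarse (coarsePt coarsePt_coe)
open Summit.QuantumFields.BalabanUV.Beta.FP.TorusGaugeCovariancePairing (wrapPt wrapPt_coe wrapPt_of_mem)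
open Summit.QuantumFields.BalabanUV.Beta.FP.TorusCompositeCovariance (rootPt rootPt_coe itRoot itRoot_succ zsmul_add_toSite_mem_pbox_fine)
open Summit.QuantumFields.BalabanUV.Beta.LinearGaugeVH (summable_of_finsupp)
open Summit.QuantumFields.BalabanUV.Beta.GAN24.HessianGaugeLegContact (exists_finset_near)
open Summit.QuantumFields.BalabanUV.Beta.FP.PeriodisedLamGaugeLegDoor (comm3)
open Summit.QuantumFields.BalabanUV.Beta.FP.PeriodisedWardOrderOnePotentials (torus_lamFamily_mul_grad_potentials tsum_coarse_regroup_pot_gen)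

variable {d : ℕ} (Lc : ℕ) [NeZero Lc]

/-! ## §0 finite bookkeeping -/

omit [NeZero Lc] in
/-- [folklore] pulling a constant bracket and a subtraction out of a weighted double sum. -/
theorem split_bookkeeping {ι κ : Type*} [Fintype ι] [Fintype κ] (w p : ℝ) (h : ι → ℝ) (X Y : ι → κ → ℝ) :
    w * ∑ ā, h ā * ∑ μ, (p * X ā μ - Y ā μ) = w * (∑ ā, h ā * ∑ μ, X ā μ) * p + -(w * ∑ ā, h ā * ∑ μ, Y ā μ) := by
  have e1 : ∀ ā, h ā * ∑ μ, (p * X ā μ - Y ā μ) = p * (h ā * ∑ μ, X ā μ) - h ā * ∑ μ, Y ā μ := fun ā => by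
    rw [Finset.sum_sub_distrib, ← Finset.mul_sum, mul_sub]; ring
  rw [Finset.sum_congr rfl fun ā _ => e1 ā, Finset.sum_sub_distrib, ← Finset.mul_sum]
  ring

omit [NeZero Lc] in
/-- [folklore] the remainder's finite bookkeeping: `Σ_ā h̄_ā Σ_μ Σ_{y₀} C(μ,y₀,ā)·Φ(y₀,μ)·Q(y₀,μ)∕L = (1∕L)·Σ_{a′} Q a′ · ((Σ_ā h̄_ā C(a′.2,a′.1,ā))·Φ(a′.1,a′.2))`. -/
theorem rem_bookkeeping {ι κ ν : Type*} [Fintype ι] [Fintype κ] [Fintype ν] (w L : ℝ) (h : ι → ℝ) (CP : ν → κ → ι → ℝ) (Φ : κ → ν → ℝ)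
    (Q : κ × ν → ℝ) :
    w * ∑ ā, h ā * ∑ μ, ∑ y₀, CP μ y₀ ā * Φ y₀ μ * Q (y₀, μ) / L
      = w / L * ∑ a', Q a' * ((∑ ā, h ā * CP a'.2 a'.1 ā) * Φ a'.1 a'.2) := by
  have eL : w * ∑ ā, h ā * ∑ μ, ∑ y₀, CP μ y₀ ā * Φ y₀ μ * Q (y₀, μ) / L
      = ∑ y₀, ∑ μ, ∑ ā, w * (h ā * (CP μ y₀ ā * Φ y₀ μ * Q (y₀, μ) / L)) := by
    rw [← comm3]
    simp only [Finset.mul_sum]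
  have eR : w / L * ∑ a', Q a' * ((∑ ā, h ā * CP a'.2 a'.1 ā) * Φ a'.1 a'.2)
      = ∑ y₀, ∑ μ, ∑ ā, w / L * (Q (y₀, μ) * (h ā * CP μ y₀ ā * Φ y₀ μ)) := by
    rw [Fintype.sum_prod_type]
    simp only [Finset.mul_sum, Finset.sum_mul]
  rw [eL, eR]
  exact Finset.sum_congr rfl fun y₀ _ => Finset.sum_congr rfl fun μ _ => Finset.sum_congr rfl fun ā _ => by ring

/-! ## §1 The Λ-family's reading SPLIT: diagonal multiplier reading + RAW next-storey remainder -/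

/-- **[folklore] `torus_lamFamily_mul_grad_potentials_split`** — on `M₁ = Lc·M₂`, the periodised Λ-family `G = w • Σ_ā h̄_ā • Λ_ā|ff` (coefficients `c` GENERIC,
summable along the `M₂`-copies) against `D = κ • of (a e ↦ φ_e(a⁺) − φ_e(a))` for ANY `M₁`-periodic potentials:
`G * D = of (a e ↦ wκ · N̂(a) · ((φ_e(a) + φ_e(a⁺)) ∕ 2)) + of (a e ↦ −(wκ · Σ_ā h̄_ā Σ_μ Σ'_y c^per_ā(μ,y) · ((φ_e(Lc•y+ρ_c) + φ_e(Lc•y+ρ_c+Lc•e_μ)) · q¹_{(μ,y)}(a) ∕ 2)))`,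
`N̂(a) := Σ_ā h̄_ā · Σ_μ Σ'_y c^per_ā(μ,y) · q¹_{(μ,y)}(a)` — `…Potentials.torus_lamFamily_mul_grad_potentials` with the bracket split (both summands finitely supported
near the bond `a`: `exists_finset_near`, `symLinKerAt_eq_zero`, `summable_of_finsupp`, `tsum_sub`). -/
theorem torus_lamFamily_mul_grad_potentials_split {N : ℕ} [NeZero N] (M₁ : Fin (d + 1) → ℕ) [∀ μ, NeZero (M₁ μ)] {M₂ : Fin (d + 1) → ℕ}
    (hM₁ : ∀ i, M₁ i = Lc * M₂ i) (c : Fin (d + 1) → Site (d + 1) → Fin (d + 1) → Site (d + 1) → ℝ)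
    (hc : ∀ κ' u μ y, Summable fun m : Site (d + 1) => c μ (translate M₂ y m) κ' u)
    (w κ : ℝ) (hbar : ↥(pbox M₁) × Fin (d + 1) → ℝ)
    {G : Matrix (↥(pbox M₁) × Fin (d + 1)) (↥(pbox M₁) × Fin (d + 1)) ℝ}
    (hG : G = w • ∑ a : ↥(pbox M₁) × Fin (d + 1), hbar a •
        (perF M₁ (dper M₁ (SLam N c (fun μ y => symHessFFAt (toSite (ctrOff (d + 1) Lc)) Lc μ y) a.2 (a.1 : Site (d + 1))))).submatrix
          (fun b : ↥(pbox M₁) × Fin (d + 1) => ((b.1, Sum.inl b.2) : Idx M₁ (Fib d)))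
          (fun b : ↥(pbox M₁) × Fin (d + 1) => ((b.1, Sum.inl b.2) : Idx M₁ (Fib d))))
    {γ : Type*} (φ : γ → Site (d + 1) → ℝ) (hφ : ∀ e z m, φ e (translate M₁ z m) = φ e z)
    {D : Matrix (↥(pbox M₁) × Fin (d + 1)) γ ℝ}
    (hD : D = κ • Matrix.of fun (a : ↥(pbox M₁) × Fin (d + 1)) (e : γ) => φ e ((a.1 : Site (d + 1)) + unitVec a.2) - φ e (a.1 : Site (d + 1))) :
    G * D = Matrix.of (fun (a : ↥(pbox M₁) × Fin (d + 1)) (e : γ) =>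
        w * κ * (∑ ā : ↥(pbox M₁) × Fin (d + 1), hbar ā *
          ∑ μ : Fin (d + 1), ∑' y : Site (d + 1), (∑' m : Site (d + 1), c μ (translate M₂ y m) ā.2 (ā.1 : Site (d + 1)))
            * symLinKerAt (toSite (ctrOff (d + 1) Lc)) Lc μ y (a.2, (a.1 : Site (d + 1))))
          * ((φ e (a.1 : Site (d + 1)) + φ e ((a.1 : Site (d + 1)) + unitVec a.2)) / 2))
      + Matrix.of (fun (a : ↥(pbox M₁) × Fin (d + 1)) (e : γ) =>
        -(w * κ * ∑ ā : ↥(pbox M₁) × Fin (d + 1), hbar ā *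
          ∑ μ : Fin (d + 1), ∑' y : Site (d + 1), (∑' m : Site (d + 1), c μ (translate M₂ y m) ā.2 (ā.1 : Site (d + 1)))
            * ((φ e ((Lc : ℤ) • y + toSite (ctrOff (d + 1) Lc)) + φ e ((Lc : ℤ) • y + toSite (ctrOff (d + 1) Lc) + (Lc : ℤ) • unitVec μ))
                * symLinKerAt (toSite (ctrOff (d + 1) Lc)) Lc μ y (a.2, (a.1 : Site (d + 1))) / 2))) := by
  classical
  have hLc1 : 1 ≤ Lc := Nat.one_le_iff_ne_zero.mpr (NeZero.ne Lc)
  have hr := ctrOff_mem_box (d := d + 1) hLc1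
  rw [torus_lamFamily_mul_grad_potentials Lc M₁ hM₁ c hc w κ hbar hG φ hφ hD]
  ext a e
  -- the inner period sum splits (both parts are finitely supported near the bond `a`)
  obtain ⟨s, hs⟩ := exists_finset_near (d := d) hLc1 (a.1 : Site (d + 1))
  have hq0 : ∀ (μ : Fin (d + 1)) (y : Site (d + 1)), y ∉ s → symLinKerAt (toSite (ctrOff (d + 1) Lc)) Lc μ y (a.2, (a.1 : Site (d + 1))) = 0 :=
    fun μ y hy => symLinKerAt_eq_zero hr (f := (a.2, (a.1 : Site (d + 1)))) (fun hn => hy (hs y hn))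
  have inner : ∀ (ā : ↥(pbox M₁) × Fin (d + 1)) (μ : Fin (d + 1)),
      ∑' y : Site (d + 1), (∑' m : Site (d + 1), c μ (translate M₂ y m) ā.2 (ā.1 : Site (d + 1)))
          * ((φ e (a.1 : Site (d + 1)) + φ e ((a.1 : Site (d + 1)) + unitVec a.2)
                - φ e ((Lc : ℤ) • y + toSite (ctrOff (d + 1) Lc)) - φ e ((Lc : ℤ) • y + toSite (ctrOff (d + 1) Lc) + (Lc : ℤ) • unitVec μ))
              * symLinKerAt (toSite (ctrOff (d + 1) Lc)) Lc μ y (a.2, (a.1 : Site (d + 1))) / 2)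
        = ((φ e (a.1 : Site (d + 1)) + φ e ((a.1 : Site (d + 1)) + unitVec a.2)) / 2)
            * ∑' y : Site (d + 1), (∑' m : Site (d + 1), c μ (translate M₂ y m) ā.2 (ā.1 : Site (d + 1)))
                * symLinKerAt (toSite (ctrOff (d + 1) Lc)) Lc μ y (a.2, (a.1 : Site (d + 1)))
          - ∑' y : Site (d + 1), (∑' m : Site (d + 1), c μ (translate M₂ y m) ā.2 (ā.1 : Site (d + 1)))
              * ((φ e ((Lc : ℤ) • y + toSite (ctrOff (d + 1) Lc)) + φ e ((Lc : ℤ) • y + toSite (ctrOff (d + 1) Lc) + (Lc : ℤ) • unitVec μ))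
                  * symLinKerAt (toSite (ctrOff (d + 1) Lc)) Lc μ y (a.2, (a.1 : Site (d + 1))) / 2) := by
    intro ā μ
    have hf : Summable fun y : Site (d + 1) => (∑' m : Site (d + 1), c μ (translate M₂ y m) ā.2 (ā.1 : Site (d + 1)))
        * symLinKerAt (toSite (ctrOff (d + 1) Lc)) Lc μ y (a.2, (a.1 : Site (d + 1))) :=
      summable_of_finsupp s fun y hy => by rw [hq0 μ y hy, mul_zero]
    have hg : Summable fun y : Site (d + 1) => (∑' m : Site (d + 1), c μ (translate M₂ y m) ā.2 (ā.1 : Site (d + 1)))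
        * ((φ e ((Lc : ℤ) • y + toSite (ctrOff (d + 1) Lc)) + φ e ((Lc : ℤ) • y + toSite (ctrOff (d + 1) Lc) + (Lc : ℤ) • unitVec μ))
            * symLinKerAt (toSite (ctrOff (d + 1) Lc)) Lc μ y (a.2, (a.1 : Site (d + 1))) / 2) :=
      summable_of_finsupp s fun y hy => by rw [hq0 μ y hy, mul_zero, zero_div, mul_zero]
    rw [← tsum_mul_left, ← Summable.tsum_sub (hf.mul_left _) hg]
    exact tsum_congr fun y => by ring
  simp only [Matrix.add_apply, Matrix.of_apply, inner]
  exact split_bookkeeping (w * κ) ((φ e (a.1 : Site (d + 1)) + φ e ((a.1 : Site (d + 1)) + unitVec a.2)) / 2) hbar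
    (fun ā μ => ∑' y : Site (d + 1), (∑' m : Site (d + 1), c μ (translate M₂ y m) ā.2 (ā.1 : Site (d + 1)))
      * symLinKerAt (toSite (ctrOff (d + 1) Lc)) Lc μ y (a.2, (a.1 : Site (d + 1))))
    (fun ā μ => ∑' y : Site (d + 1), (∑' m : Site (d + 1), c μ (translate M₂ y m) ā.2 (ā.1 : Site (d + 1)))
      * ((φ e ((Lc : ℤ) • y + toSite (ctrOff (d + 1) Lc)) + φ e ((Lc : ℤ) • y + toSite (ctrOff (d + 1) Lc) + (Lc : ℤ) • unitVec μ))
          * symLinKerAt (toSite (ctrOff (d + 1) Lc)) Lc μ y (a.2, (a.1 : Site (d + 1))) / 2))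

/-! ## §2 The RAW remainder through the next rows; §3 the diagonal multiplier reading through the next rows -/

/-- **[folklore] `rawRem_eq_neg_smul_transpose_mul`** — §1's raw remainder REGROUPED through the (0.4) rows `Q` between `M₂` and `M₁` (level `j`, slot map `cp`,
`(cp u : Site) = Lc • u`): `Rraw = −(wκ ∕ (2·(stepScale d Lc j·Lc^{d+1}))) • (Qᵀ * of (a′ e ↦ Λʰ a′ · (φ_e(Lc•a′.1 + ρ_c) + φ_e(Lc•a′.1 + ρ_c + Lc•e_{a′.2}))))`,
`Λʰ a′ := Σ_ā h̄_ā · Σ'_m c a′.2 (a′.1 + M₂∘m) ā` (`…Potentials.tsum_coarse_regroup_pot_gen` with the endpoint bracket, `M₂`-periodic by `coarseEnd_translate` + `hφ`). -/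
theorem rawRem_eq_neg_smul_transpose_mul (M₁ : Fin (d + 1) → ℕ) [∀ μ, NeZero (M₁ μ)] {M₂ : Fin (d + 1) → ℕ} [∀ μ, NeZero (M₂ μ)]
    (hM₁ : ∀ i, M₁ i = Lc * M₂ i) (cp : ↥(pbox M₂) → ↥(pbox M₁))
    (hcp : ∀ u : ↥(pbox M₂), ((cp u : ↥(pbox M₁)) : Site (d + 1)) = (Lc : ℤ) • (u : Site (d + 1))) (j : ℕ)
    {Q : Matrix (↥(pbox M₂) × Fin (d + 1)) (↥(pbox M₁) × Fin (d + 1)) ℝ}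
    (hQ : Q = (perF M₁ (bhKStepSh d Lc (Dsh Lc) j)).submatrix
        (fun a : ↥(pbox M₂) × Fin (d + 1) => ((cp a.1, Sum.inr a.2) : Idx M₁ (Fib d)))
        (fun b : ↥(pbox M₁) × Fin (d + 1) => ((b.1, Sum.inl b.2) : Idx M₁ (Fib d))))
    (c : Fin (d + 1) → Site (d + 1) → Fin (d + 1) → Site (d + 1) → ℝ) (w κ : ℝ) (hbar : ↥(pbox M₁) × Fin (d + 1) → ℝ)
    {γ : Type*} (φ : γ → Site (d + 1) → ℝ) (hφ : ∀ e z m, φ e (translate M₁ z m) = φ e z) :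
    (Matrix.of fun (a : ↥(pbox M₁) × Fin (d + 1)) (e : γ) =>
        -(w * κ * ∑ ā : ↥(pbox M₁) × Fin (d + 1), hbar ā *
          ∑ μ : Fin (d + 1), ∑' y : Site (d + 1), (∑' m : Site (d + 1), c μ (translate M₂ y m) ā.2 (ā.1 : Site (d + 1)))
            * ((φ e ((Lc : ℤ) • y + toSite (ctrOff (d + 1) Lc)) + φ e ((Lc : ℤ) • y + toSite (ctrOff (d + 1) Lc) + (Lc : ℤ) • unitVec μ))
                * symLinKerAt (toSite (ctrOff (d + 1) Lc)) Lc μ y (a.2, (a.1 : Site (d + 1))) / 2)))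
      = -(w * κ / (2 * (stepScale d Lc j * (Lc : ℝ) ^ (d + 1)))) •
        (Qᵀ * Matrix.of (fun (a' : ↥(pbox M₂) × Fin (d + 1)) (e : γ) =>
          (∑ ā : ↥(pbox M₁) × Fin (d + 1), hbar ā * ∑' m : Site (d + 1), c a'.2 (translate M₂ (a'.1 : Site (d + 1)) m) ā.2 (ā.1 : Site (d + 1)))
            * (φ e ((Lc : ℤ) • (a'.1 : Site (d + 1)) + toSite (ctrOff (d + 1) Lc))
                + φ e ((Lc : ℤ) • (a'.1 : Site (d + 1)) + toSite (ctrOff (d + 1) Lc) + (Lc : ℤ) • unitVec a'.2)))) := by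
  have hper : ∀ (e : γ) (w' : Site (d + 1)) (y k : Site (d + 1)),
      φ e ((Lc : ℤ) • translate M₂ y k + toSite (ctrOff (d + 1) Lc) + w') = φ e ((Lc : ℤ) • y + toSite (ctrOff (d + 1) Lc) + w') := by
    intro e w' y k
    rw [PeriodisedLamGaugeLegDoor.coarseEnd_translate M₂ Lc (toSite (ctrOff (d + 1) Lc)) y k w']
    obtain rfl : M₁ = fine Lc M₂ := funext hM₁
    exact hφ e _ k
  have reg : ∀ (e : γ) (a ā : ↥(pbox M₁) × Fin (d + 1)) (μ : Fin (d + 1)),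
      ∑' y : Site (d + 1), (∑' m : Site (d + 1), c μ (translate M₂ y m) ā.2 (ā.1 : Site (d + 1)))
          * ((φ e ((Lc : ℤ) • y + toSite (ctrOff (d + 1) Lc)) + φ e ((Lc : ℤ) • y + toSite (ctrOff (d + 1) Lc) + (Lc : ℤ) • unitVec μ))
              * symLinKerAt (toSite (ctrOff (d + 1) Lc)) Lc μ y (a.2, (a.1 : Site (d + 1))) / 2)
        = ∑ y₀ : ↥(pbox M₂), (∑' m : Site (d + 1), c μ (translate M₂ (y₀ : Site (d + 1)) m) ā.2 (ā.1 : Site (d + 1)))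
            * (φ e ((Lc : ℤ) • (y₀ : Site (d + 1)) + toSite (ctrOff (d + 1) Lc))
                + φ e ((Lc : ℤ) • (y₀ : Site (d + 1)) + toSite (ctrOff (d + 1) Lc) + (Lc : ℤ) • unitVec μ))
            * Q (y₀, μ) a / (2 * (stepScale d Lc j * (Lc : ℝ) ^ (d + 1))) := by
    intro e a ā μ
    refine tsum_coarse_regroup_pot_gen M₂ Lc M₁ hM₁ cp hcp j hQ c ā.2 (ā.1 : Site (d + 1)) μ a
      (Φ := fun y => φ e ((Lc : ℤ) • y + toSite (ctrOff (d + 1) Lc)) + φ e ((Lc : ℤ) • y + toSite (ctrOff (d + 1) Lc) + (Lc : ℤ) • unitVec μ))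
      (fun y k => ?_)
    have h1 := hper e 0 y k
    have h2 := hper e ((Lc : ℤ) • unitVec μ) y k
    simp only [add_zero] at h1
    simp only [h1, h2]
  ext a e
  simp only [Matrix.smul_apply, Matrix.of_apply, Matrix.mul_apply, Matrix.transpose_apply, smul_eq_mul, reg, neg_mul]
  rw [rem_bookkeeping (w * κ) (2 * (stepScale d Lc j * (Lc : ℝ) ^ (d + 1))) hbar
    (fun μ (y₀ : ↥(pbox M₂)) (ā : ↥(pbox M₁) × Fin (d + 1)) => ∑' m : Site (d + 1), c μ (translate M₂ (y₀ : Site (d + 1)) m) ā.2 (ā.1 : Site (d + 1)))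
    (fun (y₀ : ↥(pbox M₂)) μ => φ e ((Lc : ℤ) • (y₀ : Site (d + 1)) + toSite (ctrOff (d + 1) Lc))
      + φ e ((Lc : ℤ) • (y₀ : Site (d + 1)) + toSite (ctrOff (d + 1) Lc) + (Lc : ℤ) • unitVec μ))
    (fun a' => Q a' a)]

/-- **[folklore] `nhat_eq_transpose_mulVec_div`** — the un-regrouped multiplier reading through the next rows: `wκ · N̂(a) = (wκ ∕ (stepScale d Lc j·Lc^{d+1})) · (Qᵀ Λʰ)(a)`
(`…Potentials.tsum_coarse_regroup_pot_gen` with the constant bracket `2`). -/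
theorem nhat_eq_transpose_mulVec_div (M₁ : Fin (d + 1) → ℕ) [∀ μ, NeZero (M₁ μ)] {M₂ : Fin (d + 1) → ℕ} [∀ μ, NeZero (M₂ μ)]
    (hM₁ : ∀ i, M₁ i = Lc * M₂ i) (cp : ↥(pbox M₂) → ↥(pbox M₁))
    (hcp : ∀ u : ↥(pbox M₂), ((cp u : ↥(pbox M₁)) : Site (d + 1)) = (Lc : ℤ) • (u : Site (d + 1))) (j : ℕ)
    {Q : Matrix (↥(pbox M₂) × Fin (d + 1)) (↥(pbox M₁) × Fin (d + 1)) ℝ}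
    (hQ : Q = (perF M₁ (bhKStepSh d Lc (Dsh Lc) j)).submatrix
        (fun a : ↥(pbox M₂) × Fin (d + 1) => ((cp a.1, Sum.inr a.2) : Idx M₁ (Fib d)))
        (fun b : ↥(pbox M₁) × Fin (d + 1) => ((b.1, Sum.inl b.2) : Idx M₁ (Fib d))))
    (c : Fin (d + 1) → Site (d + 1) → Fin (d + 1) → Site (d + 1) → ℝ) (w κ : ℝ) (hbar : ↥(pbox M₁) × Fin (d + 1) → ℝ)
    (a : ↥(pbox M₁) × Fin (d + 1)) :
    w * κ * (∑ ā : ↥(pbox M₁) × Fin (d + 1), hbar ā *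
        ∑ μ : Fin (d + 1), ∑' y : Site (d + 1), (∑' m : Site (d + 1), c μ (translate M₂ y m) ā.2 (ā.1 : Site (d + 1)))
          * symLinKerAt (toSite (ctrOff (d + 1) Lc)) Lc μ y (a.2, (a.1 : Site (d + 1))))
      = w * κ / (stepScale d Lc j * (Lc : ℝ) ^ (d + 1)) *
        Qᵀ.mulVec (fun a' : ↥(pbox M₂) × Fin (d + 1) =>
          ∑ ā : ↥(pbox M₁) × Fin (d + 1), hbar ā * ∑' m : Site (d + 1), c a'.2 (translate M₂ (a'.1 : Site (d + 1)) m) ā.2 (ā.1 : Site (d + 1))) a := by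
  have hsc : stepScale d Lc j * (Lc : ℝ) ^ (d + 1) ≠ 0 := by
    refine mul_ne_zero ?_ (pow_ne_zero _ (Nat.cast_ne_zero.2 (NeZero.ne Lc)))
    simp only [stepScale]
    exact pow_ne_zero _ (pow_ne_zero _ (Nat.cast_ne_zero.2 (NeZero.ne Lc)))
  have reg : ∀ (ā : ↥(pbox M₁) × Fin (d + 1)) (μ : Fin (d + 1)),
      ∑' y : Site (d + 1), (∑' m : Site (d + 1), c μ (translate M₂ y m) ā.2 (ā.1 : Site (d + 1)))
          * symLinKerAt (toSite (ctrOff (d + 1) Lc)) Lc μ y (a.2, (a.1 : Site (d + 1)))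
        = ∑ y₀ : ↥(pbox M₂), (∑' m : Site (d + 1), c μ (translate M₂ (y₀ : Site (d + 1)) m) ā.2 (ā.1 : Site (d + 1))) * 2
            * Q (y₀, μ) a / (2 * (stepScale d Lc j * (Lc : ℝ) ^ (d + 1))) := by
    intro ā μ
    rw [← tsum_coarse_regroup_pot_gen M₂ Lc M₁ hM₁ cp hcp j hQ c ā.2 (ā.1 : Site (d + 1)) μ a (Φ := fun _ => (2 : ℝ)) (fun _ _ => rfl)]
    exact tsum_congr fun y => by ring
  simp only [reg, Matrix.mulVec, dotProduct, Matrix.transpose_apply]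
  rw [rem_bookkeeping (w * κ) (2 * (stepScale d Lc j * (Lc : ℝ) ^ (d + 1))) hbar
    (fun μ (y₀ : ↥(pbox M₂)) (ā : ↥(pbox M₁) × Fin (d + 1)) => ∑' m : Site (d + 1), c μ (translate M₂ (y₀ : Site (d + 1)) m) ā.2 (ā.1 : Site (d + 1)))
    (fun _ _ => (2 : ℝ)) (fun a' => Q a' a)]
  rw [Finset.mul_sum, Finset.mul_sum]
  refine Finset.sum_congr rfl fun a' _ => ?_
  field_simp

/-! ## §4 The storey potentials' top-peel recursion: iterated centred roots read at box representatives -/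

/-- [folklore] **`rootPt_wrapPt`** — the centred root point of the box representative of `z` IS the box representative (one storey down) of `Lc•z + ρ_c`. -/
theorem rootPt_wrapPt (M : Fin (d + 1) → ℕ) [∀ μ, NeZero (M μ)] (hc : ctrOff (d + 1) Lc ∈ box (d + 1) Lc) (z : Site (d + 1)) :
    rootPt M Lc hc (wrapPt M z) = wrapPt (fine Lc M) ((Lc : ℤ) • z + toSite (ctrOff (d + 1) Lc)) := by
  refine Subtype.ext ?_
  rw [rootPt_coe, ← wrap_eq_self (zsmul_add_toSite_mem_pbox_fine M Lc hc (wrapPt M z)), wrapPt_coe, wrapPt_coe]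
  refine wrap_congr (M := fine Lc M) fun i => ?_
  refine ⟨-(z i / (M i : ℤ)), ?_⟩
  simp only [Pi.add_apply, Pi.smul_apply, smul_eq_mul, wrap, fine, Nat.cast_mul]
  rw [Int.emod_def]
  ring

/-- **[folklore] `itRoot_wrapPt_succ`** — the storey potentials' recursion: reading ANY function `f` on the finest torus's sites at the `(n+1)`-fold centred root of the
representative of `z` (top `M`) = reading it at the `n`-fold centred root (top `fine Lc M`) of the representative of `Lc•z + ρ_c`:
`f (itRoot (n+1) [M] (wrapPt M z)) = f (itRoot n [fine Lc M] (wrapPt (fine Lc M) (Lc•z + ρ_c)))` (`itRoot_succ` + `rootPt_wrapPt`). -/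
theorem itRoot_wrapPt_succ (M : Fin (d + 1) → ℕ) [∀ μ, NeZero (M μ)] (hc : ctrOff (d + 1) Lc ∈ box (d + 1) Lc) (n : ℕ) (z : Site (d + 1)) :
    TorusCompositeCovariance.itRoot Lc M (fun _ => ctrOff (d + 1) Lc) (fun _ => hc) (n + 1) (wrapPt M z)
      = TorusCompositeCovariance.itRoot Lc (fine Lc M) (fun _ => ctrOff (d + 1) Lc) (fun _ => hc) n
          (wrapPt (fine Lc M) ((Lc : ℤ) • z + toSite (ctrOff (d + 1) Lc))) := by
  rw [itRoot_succ, rootPt_wrapPt]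

end Summit.QuantumFields.BalabanUV.Beta.FP.PeriodisedWardOrderOneStoreys

end
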